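import Summits.CriticalPhenomena.PercolationContinuityZ3.Theorems.PercNearOneGluingNoHeavyLowerTailSahiThreeCopyTwoPointFlow
import Summits.CriticalPhenomena.PercolationContinuityZ3.Theorems.PercNearOneGluingNoHeavyLowerTailSahiThreeCopyTwoPointFront
import Summits.CriticalPhenomena.PercolationContinuityZ3.Theorems.PercNearOneGluingNoHeavyLowerTailSahiThreeCopyUpSetsFive

/-!
# Sahi's three-function conjecture — `k = 5` certificate machinery I: FACE FORMS, HALF FORMS, and the fast `(N2)` kernel tabulation

Companion of `…TwoPointFlow` (flow-form checker) and `…UpSetsFive` (seat `prim-sahi-p1`, generation 61; `--supports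
stmt-CriticalPhenomena-4575`).  COMPUTATIONAL only through `leC_faceEmb` (`decide`).
* FACE FORMS (memo FROM-prim-sahi-p1-gen61): the flow form (products of Hall generators) certifies 3652 of the 3710 `S₅`-orbits of
  `(f, π)`, `π ∈ {1,2}^5`; the remaining block-AND slots (the `C₄`/`K₂₃`-type obstruction of memo gen59 §11(m)) need elements of the
  dual cone `(C×C)*` beyond products.  A (cross-)FACE FORM is an arbitrary `16×16` integer matrix `B` on the local codes of two
  4-dimensional faces `{bit_i = v}`, `{bit_j = v'}` of `{0,1}^5` (`faceEmb`, order embeddings: `leC_faceEmb`), VALID when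
  `Σ_{u ∈ V', w ∈ W'} B[u][w] ≥ 0` for all `168²` pairs of up-closed local families (`faceOK`); ★ `faceKer_sum_nonneg`: a valid face form is
  nonnegative on every pair of up-closed families of the big cube.  HALF FORMS (`32×16`, cube × face; `halfOK` on `upList5 × upSetsC 4`;
  ★ `halfKer_sum_nonneg`, `halfKerT_sum_nonneg`) likewise.
* `arrTouch`/`N2Z_single_touch`/`kmat2F`/★ `kmat2F_eq`/`certOKflowXF(_eq)`: the `(N2)` kernel at singletons only sees arrangements touching
  the row level — the same values as the tree's `kmat2` with `2^4×` fewer terms (the per-entry cost of the `k = 5` checks).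
Nothing conjectural is used. [this work]
-/

namespace Summit.CriticalPhenomena.PercolationContinuityZ3.Theorems.SahiThreeCopy

open Finset Function Literature.Combinatorics.Sahi2008
open scoped BigOperators

section FaceForms

/-- Little-endian digits of `m` in base `B` (`n` of them). [this work] -/
def digitsLE (B : ℕ) : ℕ → ℕ → List ℕ
  | 0, _ => []
  | n + 1, m => (m % B) :: digitsLE B n (m / B)

/-- The embedding of the `16` local codes of the face `{x : bit_i(x) = v}` of `{0,1}^5` into the `32` codes (insert the bit `v` at
position `i`). [this work] -/
def faceEmb (i v : ℕ) (u : Fin (2 ^ 4)) : Fin (2 ^ 5) :=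
  Fin.ofNat (2 ^ 5) ((u : ℕ) % 2 ^ i + v * 2 ^ i + (u : ℕ) / 2 ^ i * 2 ^ (i + 1))

/-- The face embeddings are order embeddings (finite check, all `i < 5`, `v < 2`). [this work] -/
theorem leC_faceEmb : ∀ (i : Fin 5) (v : Fin 2) (u u' : Fin (2 ^ 4)), LeC u u' → LeC (faceEmb i v u) (faceEmb i v u') := by
  decide

/-- A (cross-)face form: a `16 × 16` integer matrix `B` on local codes of the faces `{bit_i = v}` (rows) and `{bit_j = v'}`
(columns); its GLOBAL kernel on `{0,1}^5` codes. [this work] -/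
def faceKer (i v j v' : ℕ) (B : Vector (Vector ℤ (2 ^ 4)) (2 ^ 4)) (x y : Fin (2 ^ 5)) : ℤ :=
  ∑ u : Fin (2 ^ 4), ∑ w : Fin (2 ^ 4), if faceEmb i v u = x ∧ faceEmb j v' w = y then (B[u])[w] else 0

/-- Row sums of a face form over a local family. [this work] -/
def faceRow (B : Vector (Vector ℤ (2 ^ 4)) (2 ^ 4)) (V : Finset (Fin (2 ^ 4))) : Array ℤ :=
  Array.ofFn fun w : Fin (2 ^ 4) => ∑ u ∈ V, (B[u])[w]

/-- Validity of a face form: `Σ_{u ∈ V', w ∈ W'} B[u][w] ≥ 0` for all pairs from `U4` (to be the `168` up-closed local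
families, passed as a parameter so that the compiled check evaluates it once). [this work] -/
def faceOK (U4 : Finset (Finset (Fin (2 ^ 4)))) (B : Vector (Vector ℤ (2 ^ 4)) (2 ^ 4)) : Bool :=
  allMem U4 fun V =>
    let r := faceRow B V
    allMem U4 fun W => decide (0 ≤ ∑ w ∈ W, r.getD (w : ℕ) 0)

/-- Reading a face row sum. [this work] -/
theorem faceRow_getD (B : Vector (Vector ℤ (2 ^ 4)) (2 ^ 4)) (V : Finset (Fin (2 ^ 4))) (w : Fin (2 ^ 4)) :
    (faceRow B V).getD (w : ℕ) 0 = ∑ u ∈ V, (B[u])[w] := by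
  unfold faceRow
  have hw : (w : ℕ) < (Array.ofFn fun w : Fin (2 ^ 4) => ∑ u ∈ V, (B[u])[w]).size := by rw [Array.size_ofFn]; exact w.isLt
  rw [Array.getD_eq_getD_getElem?, Array.getElem?_eq_getElem hw, Option.getD_some, Array.getElem_ofFn]

/-- Unpacking `faceOK`. [this work] -/
theorem sum_nonneg_of_faceOK {B : Vector (Vector ℤ (2 ^ 4)) (2 ^ 4)} (h : faceOK (upSetsC 4) B = true) {V W : Finset (Fin (2 ^ 4))}
    (hV : V ∈ upSetsC 4) (hW : W ∈ upSetsC 4) : 0 ≤ ∑ u ∈ V, ∑ w ∈ W, (B[u])[w] := by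
  unfold faceOK at h
  have h1 := (allMem_eq_true.1 ((allMem_eq_true.1 h) V hV)) W hW
  rw [decide_eq_true_eq] at h1
  simp only [faceRow_getD] at h1
  rw [Finset.sum_comm] at h1
  exact h1

/-- ★ **A valid face form is nonnegative on every pair of up-closed families of the big cube.**  [this work] -/
theorem faceKer_sum_nonneg {i : Fin 5} {v : Fin 2} {j : Fin 5} {v' : Fin 2} {B : Vector (Vector ℤ (2 ^ 4)) (2 ^ 4)}
    (hB : faceOK (upSetsC 4) B = true) {V W : Finset (Fin (2 ^ 5))} (hV : V ∈ upSetsC 5) (hW : W ∈ upSetsC 5) :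
    0 ≤ ∑ x ∈ V, ∑ y ∈ W, faceKer i v j v' B x y := by
  -- local traces of V and W
  set VL : Finset (Fin (2 ^ 4)) := univ.filter fun u => faceEmb i v u ∈ V with hVL
  set WL : Finset (Fin (2 ^ 4)) := univ.filter fun w => faceEmb j v' w ∈ W with hWL
  have hVu : UpClosedC V := by simpa [upSetsC] using hV
  have hWu : UpClosedC W := by simpa [upSetsC] using hW
  have hVL' : VL ∈ upSetsC 4 := by
    simp only [upSetsC, mem_filter, mem_univ, true_and]
    intro u hu u' huu'
    simp only [hVL, mem_filter, mem_univ, true_and] at hu ⊢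
    exact hVu _ hu _ (leC_faceEmb i v u u' huu')
  have hWL' : WL ∈ upSetsC 4 := by
    simp only [upSetsC, mem_filter, mem_univ, true_and]
    intro u hu u' huu'
    simp only [hWL, mem_filter, mem_univ, true_and] at hu ⊢
    exact hWu _ hu _ (leC_faceEmb j v' u u' huu')
  have key : ∑ x ∈ V, ∑ y ∈ W, faceKer i v j v' B x y = ∑ u ∈ VL, ∑ w ∈ WL, (B[u])[w] := by
    unfold faceKer
    -- bring the sums over `u, w` outside
    have e1 : ∀ x : Fin (2 ^ 5), ∑ y ∈ W, ∑ u : Fin (2 ^ 4), ∑ w : Fin (2 ^ 4),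
        (if faceEmb i v u = x ∧ faceEmb j v' w = y then (B[u])[w] else 0) =
        ∑ u : Fin (2 ^ 4), ∑ w : Fin (2 ^ 4), ∑ y ∈ W, (if faceEmb i v u = x ∧ faceEmb j v' w = y then (B[u])[w] else 0) := by
      intro x
      rw [Finset.sum_comm]
      exact Finset.sum_congr rfl fun u _ => Finset.sum_comm
    simp_rw [e1]
    rw [Finset.sum_comm]
    have e2 : ∀ u : Fin (2 ^ 4), ∑ x ∈ V, ∑ w : Fin (2 ^ 4), ∑ y ∈ W,
        (if faceEmb i v u = x ∧ faceEmb j v' w = y then (B[u])[w] else 0) =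
        ∑ w : Fin (2 ^ 4), ∑ x ∈ V, ∑ y ∈ W, (if faceEmb i v u = x ∧ faceEmb j v' w = y then (B[u])[w] else 0) :=
      fun u => Finset.sum_comm
    simp_rw [e2]
    -- pointwise evaluation of the inner double sum
    have e3 : ∀ (u w : Fin (2 ^ 4)), ∑ x ∈ V, ∑ y ∈ W, (if faceEmb i v u = x ∧ faceEmb j v' w = y then (B[u])[w] else 0) =
        if faceEmb i v u ∈ V then (if faceEmb j v' w ∈ W then (B[u])[w] else 0) else 0 := by
      intro u w
      have : ∀ x ∈ V, ∑ y ∈ W, (if faceEmb i v u = x ∧ faceEmb j v' w = y then (B[u])[w] else 0) =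
          if faceEmb i v u = x then (if faceEmb j v' w ∈ W then (B[u])[w] else 0) else 0 := by
        intro x _
        by_cases hx : faceEmb i v u = x
        · simp only [hx, true_and, if_true, Finset.sum_ite_eq]
        · simp only [hx, false_and, if_false, Finset.sum_const_zero]
      rw [Finset.sum_congr rfl this, Finset.sum_ite_eq]
    simp_rw [e3]
    -- the filtered families
    rw [hVL, Finset.sum_filter]
    refine Finset.sum_congr rfl fun u _ => ?_
    by_cases hu : faceEmb i v u ∈ V
    · simp only [hu, if_true, hWL, Finset.sum_filter]
    · simp only [hu, if_false, Finset.sum_const_zero]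
  rw [key]
  exact sum_nonneg_of_faceOK hB hVL' hWL'

end FaceForms


/-! ### Half forms: bilinear forms on (whole cube) × (face), verified on `upList5 × upSetsC 4` -/

section HalfForms

/-- A HALF FORM `B` (`32 × 16`): rows = all codes of `{0,1}^5`, columns = local codes of the face `{bit_j = v}`; its global kernel. [this work] -/
def halfKer (j v : ℕ) (B : Vector (Vector ℤ (2 ^ 4)) (2 ^ 5)) (x y : Fin (2 ^ 5)) : ℤ :=
  ∑ w : Fin (2 ^ 4), if faceEmb j v w = y then (B[x])[w] else 0

/-- The transposed HALF FORM (`16 × 32`): rows = local codes of the face `{bit_j = v}`, columns = all codes. [this work] -/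
def halfKerT (j v : ℕ) (B : Vector (Vector ℤ (2 ^ 5)) (2 ^ 4)) (x y : Fin (2 ^ 5)) : ℤ :=
  ∑ u : Fin (2 ^ 4), if faceEmb j v u = x then (B[u])[y] else 0

/-- Validity of a half form: nonnegative on all pairs (family from `U5`) × (local family from `U4`). [this work] -/
def halfOK (U5 : Finset (Finset (Fin (2 ^ 5)))) (U4 : Finset (Finset (Fin (2 ^ 4)))) (B : Vector (Vector ℤ (2 ^ 4)) (2 ^ 5)) : Bool :=
  allMem U5 fun V =>
    let r : Array ℤ := Array.ofFn fun w : Fin (2 ^ 4) => ∑ x ∈ V, (B[x])[w]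
    allMem U4 fun W => decide (0 ≤ ∑ w ∈ W, r.getD (w : ℕ) 0)

/-- Validity of a transposed half form. [this work] -/
def halfOKT (U5 : Finset (Finset (Fin (2 ^ 5)))) (U4 : Finset (Finset (Fin (2 ^ 4)))) (B : Vector (Vector ℤ (2 ^ 5)) (2 ^ 4)) :
    Bool :=
  allMem U4 fun V =>
    let r : Array ℤ := Array.ofFn fun y : Fin (2 ^ 5) => ∑ u ∈ V, (B[u])[y]
    allMem U5 fun W => decide (0 ≤ ∑ y ∈ W, r.getD (y : ℕ) 0)

/-- Reading an `Array.ofFn` (plumbing). [folklore] -/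
theorem getD_ofFn_fin {n : ℕ} (g : Fin n → ℤ) (w : Fin n) : (Array.ofFn g).getD (w : ℕ) 0 = g w := by
  have hw : (w : ℕ) < (Array.ofFn g).size := by rw [Array.size_ofFn]; exact w.isLt
  rw [Array.getD_eq_getD_getElem?, Array.getElem?_eq_getElem hw, Option.getD_some, Array.getElem_ofFn]

/-- ★ A valid half form is nonnegative on every pair of up-closed families of the big cube. [this work] -/
theorem halfKer_sum_nonneg {j : Fin 5} {v : Fin 2} {B : Vector (Vector ℤ (2 ^ 4)) (2 ^ 5)} (hB : halfOK upList5 (upSetsC 4) B = true)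
    {V W : Finset (Fin (2 ^ 5))} (hV : V ∈ upSetsC 5) (hW : W ∈ upSetsC 5) :
    0 ≤ ∑ x ∈ V, ∑ y ∈ W, halfKer j v B x y := by
  set WL : Finset (Fin (2 ^ 4)) := univ.filter fun w => faceEmb j v w ∈ W with hWL
  have hWu : UpClosedC W := upClosedC_of_mem hW
  have hWL' : WL ∈ upSetsC 4 := by
    simp only [upSetsC, mem_filter, mem_univ, true_and]
    intro u hu u' huu'
    simp only [hWL, mem_filter, mem_univ, true_and] at hu ⊢
    exact hWu _ hu _ (leC_faceEmb j v u u' huu')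
  have hV5 : V ∈ upList5 := mem_upList5 (upClosedC_of_mem hV)
  have key : ∑ x ∈ V, ∑ y ∈ W, halfKer j v B x y = ∑ w ∈ WL, ∑ x ∈ V, (B[x])[w] := by
    unfold halfKer
    have e1 : ∀ x ∈ V, ∑ y ∈ W, ∑ w : Fin (2 ^ 4), (if faceEmb j v w = y then (B[x])[w] else 0) =
        ∑ w : Fin (2 ^ 4), if faceEmb j v w ∈ W then (B[x])[w] else 0 := by
      intro x _
      rw [Finset.sum_comm]
      exact Finset.sum_congr rfl fun w _ => Finset.sum_ite_eq W (faceEmb j v w) _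
    rw [Finset.sum_congr rfl e1, Finset.sum_comm, hWL, Finset.sum_filter]
    refine Finset.sum_congr rfl fun w _ => ?_
    by_cases hw : faceEmb j v w ∈ W
    · simp only [hw, if_true]
    · simp only [hw, if_false, Finset.sum_const_zero]
  rw [key]
  unfold halfOK at hB
  have h1 := (allMem_eq_true.1 ((allMem_eq_true.1 hB) V hV5)) WL hWL'
  rw [decide_eq_true_eq] at h1
  simp only [getD_ofFn_fin] at h1
  exact h1

/-- ★ A valid transposed half form is nonnegative on every pair of up-closed families of the big cube. [this work] -/
theorem halfKerT_sum_nonneg {j : Fin 5} {v : Fin 2} {B : Vector (Vector ℤ (2 ^ 5)) (2 ^ 4)}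
    (hB : halfOKT upList5 (upSetsC 4) B = true) {V W : Finset (Fin (2 ^ 5))} (hV : V ∈ upSetsC 5) (hW : W ∈ upSetsC 5) :
    0 ≤ ∑ x ∈ V, ∑ y ∈ W, halfKerT j v B x y := by
  set VL : Finset (Fin (2 ^ 4)) := univ.filter fun u => faceEmb j v u ∈ V with hVL
  have hVu : UpClosedC V := upClosedC_of_mem hV
  have hVL' : VL ∈ upSetsC 4 := by
    simp only [upSetsC, mem_filter, mem_univ, true_and]
    intro u hu u' huu'
    simp only [hVL, mem_filter, mem_univ, true_and] at hu ⊢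
    exact hVu _ hu _ (leC_faceEmb j v u u' huu')
  have hW5 : W ∈ upList5 := mem_upList5 (upClosedC_of_mem hW)
  have key : ∑ x ∈ V, ∑ y ∈ W, halfKerT j v B x y = ∑ u ∈ VL, ∑ y ∈ W, (B[u])[y] := by
    unfold halfKerT
    have e1 : ∀ x ∈ V, ∑ y ∈ W, ∑ u : Fin (2 ^ 4), (if faceEmb j v u = x then (B[u])[y] else 0) =
        ∑ u : Fin (2 ^ 4), if faceEmb j v u = x then ∑ y ∈ W, (B[u])[y] else 0 := by
      intro x _
      rw [Finset.sum_comm]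
      refine Finset.sum_congr rfl fun u _ => ?_
      by_cases hu : faceEmb j v u = x
      · simp only [hu, if_true]
      · simp only [hu, if_false, Finset.sum_const_zero]
    rw [Finset.sum_congr rfl e1, Finset.sum_comm]
    have e2 : ∀ u : Fin (2 ^ 4), ∑ x ∈ V, (if faceEmb j v u = x then ∑ y ∈ W, (B[u])[y] else 0) =
        if faceEmb j v u ∈ V then ∑ y ∈ W, (B[u])[y] else 0 := fun u => Finset.sum_ite_eq V (faceEmb j v u) _
    simp_rw [e2]
    rw [hVL, Finset.sum_filter]
  rw [key]
  unfold halfOKT at hB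
  have h1 := (allMem_eq_true.1 ((allMem_eq_true.1 hB) VL hVL')) W hW5
  rw [decide_eq_true_eq] at h1
  simp only [getD_ofFn_fin] at h1
  rw [Finset.sum_comm]
  exact h1

end HalfForms

/-! ### A faster tabulation of the `(N2)` kernel (only arrangements touching the row level contribute) -/

section FastKernel

variable {k : ℕ}

/-- The arrangements whose first or second copy sits at level `x`. [this work] -/
def arrTouch (A : Finset (Fin (2 ^ k) × Fin (2 ^ k) × Fin (2 ^ k))) (x : Fin (2 ^ k)) :
    Finset (Fin (2 ^ k) × Fin (2 ^ k) × Fin (2 ^ k)) :=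
  A.filter fun σ => σ.1 = x ∨ σ.2.1 = x

/-- The `(N2)` kernel at singletons only sees arrangements touching the row level. [this work] -/
theorem N2Z_single_touch (S : ℕ) (A : Finset (Fin (2 ^ k) × Fin (2 ^ k) × Fin (2 ^ k))) (F : Finset (Fin (2 ^ k)))
    (tab : Array ℤ) (x y : Fin (2 ^ k)) : N2Z S (arrTouch A x) F tab {x} {y} = N2Z S A F tab {x} {y} := by
  unfold N2Z arrTouch
  apply Finset.sum_filter_of_ne
  intro σ _ hne
  by_contra h
  apply hne
  have h1 : mZ {x} σ.1 = 0 := by unfold mZ; rw [if_neg]; rw [Finset.mem_singleton]; exact fun e => h (Or.inl e)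
  have h2 : mZ {x} σ.2.1 = 0 := by unfold mZ; rw [if_neg]; rw [Finset.mem_singleton]; exact fun e => h (Or.inr e)
  rw [h1, h2]; ring

/-- The `(N2)` kernel tabulated through the touching arrangements (same values as `kmat2`, ~`2^k/2` times fewer terms). [this work] -/
def kmat2F (S : ℕ) (A : Finset (Fin (2 ^ k) × Fin (2 ^ k) × Fin (2 ^ k))) (F : Finset (Fin (2 ^ k))) (tab : Array ℤ) :
    Vector (Vector ℤ (2 ^ k)) (2 ^ k) :=
  let AX : Vector (Finset (Fin (2 ^ k) × Fin (2 ^ k) × Fin (2 ^ k))) (2 ^ k) := Vector.ofFn fun x => arrTouch A x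
  Vector.ofFn fun x => Vector.ofFn fun y => N2Z S (AX[x]) F tab {x} {y}

/-- `kmat2F = kmat2`. [this work] -/
theorem kmat2F_eq (S : ℕ) (A : Finset (Fin (2 ^ k) × Fin (2 ^ k) × Fin (2 ^ k))) (F : Finset (Fin (2 ^ k))) (tab : Array ℤ) :
    kmat2F S A F tab = kmat2 S A F tab := by
  unfold kmat2F kmat2
  simp only [Fin.getElem_fin, Vector.getElem_ofFn, N2Z_single_touch]

/-- The flow-form check with the fast kernel tabulation. [this work] -/
def certOKflowXF (S : ℕ) (A : Finset (Fin (2 ^ k) × Fin (2 ^ k) × Fin (2 ^ k))) (F : Finset (Fin (2 ^ k))) (tab : Array ℤ)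
    (nu : List (ℕ × ℕ × ℕ)) (lam : List (ℕ × ℕ × ℕ × ℕ × ℕ)) (X : Vector (Vector ℤ (2 ^ k)) (2 ^ k)) : Bool :=
  let d1 := diag1 S A F tab
  let K2 := kmat2F S A F tab
  let T1 := nuTable k nu
  let T2 := lamTable k lam
  decide (∀ x : Fin (2 ^ k), 0 ≤ thetaZ tab x) && nu.all (nuOK k) && lam.all (lamOK k) &&
    decide (∀ x : Fin (2 ^ k), T1[x] ≤ d1.getD (x : ℕ) 0) &&
    decide (∀ x : Fin (2 ^ k), ∀ y : Fin (2 ^ k), (T2[x])[y] + (X[x])[y] ≤ (K2[x])[y])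

/-- The fast check is the check. [this work] -/
theorem certOKflowXF_eq (S : ℕ) (A : Finset (Fin (2 ^ k) × Fin (2 ^ k) × Fin (2 ^ k))) (F : Finset (Fin (2 ^ k))) (tab : Array ℤ)
    (nu : List (ℕ × ℕ × ℕ)) (lam : List (ℕ × ℕ × ℕ × ℕ × ℕ)) (X : Vector (Vector ℤ (2 ^ k)) (2 ^ k)) :
    certOKflowXF S A F tab nu lam X = certOKflowX S A F tab nu lam X := by
  unfold certOKflowXF certOKflowX
  rw [kmat2F_eq]

end FastKernel

end Summit.CriticalPhenomena.PercolationContinuityZ3.Theorems.SahiThreeCopy
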